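import Summits.QuantumFields.YangMills.Theorems.UnitScaleTiltHalvingP1FlatCoreTransportAssembly
import Summits.QuantumFields.YangMills.Theorems.UnitScaleTiltHalvingP1FlatCoreExtraction
import HarnessLib

/-!
# Route `UnitScaleTilt`, crux K1 child «MinimiserStabilityRegPr» (stmt-QuantumFields-19200), registered stub V2′ `stub_halvingStep` (v10 `BirthV10`) —
# **J6: THE TORUS ∕ ℤ³ POINTWISE JUNCTION** — from an `SU(2)`-valued `ℤ³` gauge `w` (the J4 pair's composite pre-gauge · Prop-5 gauge) and the `ℤ³` chart one-form `X`
# of the gauged periodic pull-back, the TORUS gauge `u := w ∘ rep` and the TORUS one-form `A := X ∘ rep` on the bonds of `□₀^{route}` (`0` off them) satisfy, by pointwise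
# rewriting, the displayed junction hypotheses of ✓`HalvingP1FlatCoreTransportAssembly.multiplierForm_of_flatLandau_window` (`hpt`) and of
# ✓`HalvingP1FlatCoreExtraction.core'_of_mlogChart` (`hnear`, `hA`, `hA0`)

Cell `ym3-torus` (HUMAN RULING D-0037, YM ladder rung R3 — continuum SU(2) YM₃ on the three-torus is a RUNG, NOT the Clay problem), width seat `ym-ust-19936-w7`
gen 4, cross-item hand on line H (LEAD-H ★w5-19200 g4 12:1xZ «J6 junction → ★w7-19936 g4: MINE = YES, GO»; tag worded by the OWNER:
`--supports stmt-QuantumFields-19200 --as helper`).  Definition-free, 0 sorry, standard axioms.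

WHY (LEAD-H 11:27:33Z «junctions are POINTWISE only»).  The J4 chain runs on `ℤ³` at N05's member (window `□₀^{N05} = cube L a M′ ρ′ k 0`); J5∕J5b read a torus gauge `u`
and a torus one-form `A`.  With J1b's representatives `rep s := lift x₀ + rel x₀ s` (✓`lift_add_rel_mem_cube_zero`, ✓`cover_lift_add_rel`) the junction is: `u s := w (rep s)`,
`A b := X (rep b₋) b.dir` when both ends of `b` lie in `□₀^{route}`, `0` otherwise.  The one geometric fact needed is REP-COHERENCE `rep (s + e_ν) = rep s + e_ν` for
neighbouring sites of `□₀^{route}` (§1, from a near-uniqueness of representatives under J1b's room premise).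
* §1 `eq_of_cover_eq_of_near_cube_zero` (a point within `1` of the window and a window point with the same torus image coincide), ★`rep_shift` (rep-coherence),
  `rep_transl_eq` (`rep (0 + z) = z` for window points).
* §2 ★★ `junction_hpt` — `hpt` of ✓`multiplierForm_of_flatLandau_window` for `A := X ∘ rep`.
* §3 ★★ `junction_chart` — `hnear`∕`hA`∕`hA0` of ✓`core'_of_mlogChart` at `Ω₀ := □₀^{route}` for `u := w ∘ rep`, `A := X ∘ rep`, from the `ℤ³` chart hypotheses
  `‖W♯_b − 1‖ ≤ 1∕4`, `i·η·X = log W♯_b`, `W♯_b := w(z)⁻¹·U⟨0+z,ν⟩·w(z+e_ν)` on the window bonds over `□₀^{route}`.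
HONEST SCOPE.  Pointwise bookkeeping; the chart, the gauge and their sizes are HYPOTHESES (J3∕J4).  NOT a claim about [Balaban1985RegularSpaces] Thm 2, the stub, the crux,
the rung or the mass gap; no summit statement is proved by this seat.

References: T. Bałaban, CMP **99** (1985) 75–102 [Balaban1985RegularSpaces] (1.36)–(1.38) p.82, p.98; CMP **109** (1987) 249–301 [Balaban1987RG1] (0.1) p.251 (torus ∕ ℤᵈ bookkeeping).
-/

set_option autoImplicit false

noncomputable section

open scoped BigOperators Matrix.Norms.L2Operator

namespace Summit.QuantumFields.YangMills.Theorems.HalvingP1FlatCoreJunction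

open Literature.MathematicalPhysics.QuantumFieldTheory.Balaban1983to89
open Literature.MathematicalPhysics.QuantumFieldTheory.Balaban1983to89.T3ContinuumYM3Torus
open Complex (I)
open MatrixLog (mlog)
open B7Prop1Explicit renaming Site → LSite
open B7Prop1Explicit (e)
open B8Eq131Cubes (cube gs bLo bHi sqLo sqHi)
open B5Eq118OneStroke (iterBlockOf)
open B10Eq27TorusAxialLog (transl transl_add_e rel unitsField toUField suIncl)
open B15Eq112TorusCover (cover cover_apply lift)
open FlatCubeSequenceAligned (cubeSetM)
open P1FlatCoreCubeInclusion (transl_zero_eq_cover cover_lift_add_rel lift_add_rel_mem_cube_zero eq_of_cover_eq_of_mem_cube_zero abs_sub_le_of_mem_cube_zero)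

variable {P : Params}

/-! ## §1 Representatives: near-uniqueness, rep-coherence -/

/-- **NEAR-UNIQUENESS**: a point within `1` (coordinatewise) of N05's window and a window point with the same torus image coincide (room premise: the window's diameter `+ 1`
is below the period). [cite: Balaban1987RG1, (0.1) p.251] -/
theorem eq_of_cover_eq_of_near_cube_zero {k : ℕ} {a : LSite P.d} {M' ρ' : ℕ}
    (hroom : 2 * (P.L ^ k * (M' + 1) + ρ' * gs P.L k) ≤ P.sitesPerDir 0)
    {z z'' z' : LSite P.d} (hz : z ∈ cube P.L a M' ρ' k 0) (hzz : ∀ ν, |z'' ν - z ν| ≤ 1) (hz' : z' ∈ cube P.L a M' ρ' k 0)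
    (h : cover P z'' = cover P z') : z'' = z' := by
  funext ν
  have hν : ((z'' ν : ℤ) : ZMod (P.sitesPerDir 0)) = ((z' ν : ℤ) : ZMod (P.sitesPerDir 0)) := by
    have := congrFun h ν
    rwa [cover_apply, cover_apply] at this
  have hdvd : ((P.sitesPerDir 0 : ℕ) : ℤ) ∣ z' ν - z'' ν := (ZMod.intCast_eq_intCast_iff_dvd_sub (z'' ν) (z' ν) _).1 hν
  have hD := abs_sub_le_of_mem_cube_zero hz hz' ν
  have hr : (2 : ℤ) * ((P.L : ℤ) ^ k * ((M' : ℤ) + 1) + (ρ' : ℤ) * (gs P.L k : ℤ)) ≤ (P.sitesPerDir 0 : ℤ) := by exact_mod_cast hroom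
  have hQ : (1 : ℤ) ≤ (P.L : ℤ) ^ k := one_le_pow₀ (by exact_mod_cast P.L_pos)
  have hM'0 : (0 : ℤ) ≤ (P.L : ℤ) ^ k * (M' : ℤ) := by positivity
  have h1 := hzz ν
  have hlt : |z' ν - z'' ν| < (P.sitesPerDir 0 : ℤ) := by
    have : |z' ν - z'' ν| ≤ |z' ν - z ν| + |z'' ν - z ν| := by
      rw [show z' ν - z'' ν = (z' ν - z ν) - (z'' ν - z ν) by ring]
      exact abs_sub _ _
    nlinarith
  have h0 := Int.eq_zero_of_abs_lt_dvd hdvd hlt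
  linarith

/-- ★ **REP-COHERENCE**: for neighbouring sites `s`, `s + e_ν` of `□₀^{route}` the representatives are neighbours: `rep (s + e_ν) = rep s + e_ν` (J1b's binders).
[cite: Balaban1987RG1, (0.1) p.251] -/
theorem rep_shift {x₀ : Site P 0} {k : ℕ} (hk : k ≤ P.m + P.K) {ρ S M : ℕ} (hM : 1 ≤ M)
    {a : LSite P.d} {M' ρ' : ℕ} (h0 : ρ + M ≤ ρ' + 1) (h1 : P.L + S + M ≤ ρ' + 2)
    (ha : ∀ ν, a ν ≤ ((iterBlockOf k x₀ ν).val : ℤ) ∧ ((iterBlockOf k x₀ ν).val : ℤ) ≤ a ν + M' - 1)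
    (hroom : 2 * (P.L ^ k * (M' + 1) + ρ' * gs P.L k) ≤ P.sitesPerDir 0)
    {s : Site P 0} (hs : s ∈ cubeSetM x₀ k ρ S M 0) (ν : Fin P.d) (hs' : s.shift ν ∈ cubeSetM x₀ k ρ S M 0) :
    lift P x₀ + rel x₀ (s.shift ν) = (lift P x₀ + rel x₀ s) + e ν := by
  refine (eq_of_cover_eq_of_near_cube_zero hroom (lift_add_rel_mem_cube_zero hk hM h0 h1 ha hs) (fun μ => ?_)
    (lift_add_rel_mem_cube_zero hk hM h0 h1 ha hs') ?_).symm
  · simp only [Pi.add_apply, e, Pi.single_apply, add_sub_cancel_left]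
    split_ifs <;> simp
  · rw [cover_lift_add_rel, ← transl_zero_eq_cover, transl_add_e, transl_zero_eq_cover, cover_lift_add_rel]

/-- The representative of the torus image of a window point is the point. [cite: Balaban1987RG1, (0.1) p.251] -/
theorem rep_transl_eq {x₀ : Site P 0} {k : ℕ} (hk : k ≤ P.m + P.K) {ρ S M : ℕ} (hM : 1 ≤ M)
    {a : LSite P.d} {M' ρ' : ℕ} (h0 : ρ + M ≤ ρ' + 1) (h1 : P.L + S + M ≤ ρ' + 2)
    (ha : ∀ ν, a ν ≤ ((iterBlockOf k x₀ ν).val : ℤ) ∧ ((iterBlockOf k x₀ ν).val : ℤ) ≤ a ν + M' - 1)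
    (hroom : 2 * (P.L ^ k * (M' + 1) + ρ' * gs P.L k) ≤ P.sitesPerDir 0)
    {z : LSite P.d} (hz : z ∈ cube P.L a M' ρ' k 0) (hs : transl (0 : Site P 0) z ∈ cubeSetM x₀ k ρ S M 0) :
    lift P x₀ + rel x₀ (transl (0 : Site P 0) z) = z :=
  eq_of_cover_eq_of_mem_cube_zero hroom (lift_add_rel_mem_cube_zero hk hM h0 h1 ha hs) hz
    (by rw [cover_lift_add_rel, transl_zero_eq_cover])

/-! ## §2 `hpt` of the (iv) transport -/

section Torus

variable {F : T3Family} {n K : ℕ}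

open Classical in
/-- ★★ **THE POINTWISE JUNCTION `hpt`** of ✓`multiplierForm_of_flatLandau_window` for the torus one-form `A := X ∘ rep` (`0` off the bonds of `□₀^{route}`): on a window point `w`
whose torus bond has both ends in `□₀^{route}`, `X w ν = A⟨0 + w, ν⟩`. [cite: Balaban1985RegularSpaces, (1.38) p.82] -/
theorem junction_hpt (x₀ : Site (F.P K) 0) (ρ S M : ℕ) (hM : 1 ≤ M)
    {a : LSite (F.P K).d} {M' ρ' : ℕ} (h0 : ρ + M ≤ ρ' + 1) (h1 : (F.P K).L + S + M ≤ ρ' + 2)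
    (ha : ∀ ν, a ν ≤ ((iterBlockOf (K - n) x₀ ν).val : ℤ) ∧ ((iterBlockOf (K - n) x₀ ν).val : ℤ) ≤ a ν + M' - 1)
    (hroom : 2 * ((F.P K).L ^ (K - n) * (M' + 1) + ρ' * gs (F.P K).L (K - n)) ≤ (F.P K).sitesPerDir 0)
    (X : LSite (F.P K).d → Fin (F.P K).d → Matrix (Fin 2) (Fin 2) ℂ) :
    ∀ w ∈ cube (F.P K).L a M' ρ' (K - n) 0, ∀ ν : Fin (F.P K).d,
      transl (0 : Site (F.P K) 0) w ∈ cubeSetM x₀ (K - n) ρ S M 0 → (transl (0 : Site (F.P K) 0) w).shift ν ∈ cubeSetM x₀ (K - n) ρ S M 0 →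
      X w ν = (fun b : PBond (F.P K) 0 => if b.src ∈ cubeSetM x₀ (K - n) ρ S M 0 ∧ b.tgt ∈ cubeSetM x₀ (K - n) ρ S M 0 then
        X (lift (F.P K) x₀ + rel x₀ b.src) b.dir else 0) ⟨transl 0 w, ν⟩ := by
  intro w hw ν hs hs'
  have hk : K - n ≤ (F.P K).m + (F.P K).K := FlatMinimizerH.le_T3 F n K
  dsimp only
  rw [if_pos ⟨hs, hs'⟩, rep_transl_eq hk hM h0 h1 ha hroom hw hs]

/-! ## §3 `hnear` ∕ `hA` ∕ `hA0` of the chart-defined extraction -/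

open Classical in
/-- ★★ **THE CHART JUNCTION** for ✓`HalvingP1FlatCoreExtraction.core'_of_mlogChart` at `Ω₀ := □₀^{route}`, torus gauge `u := w ∘ rep`, torus one-form `A := X ∘ rep` (`0` off):
from the `ℤ³` chart rows on the window bonds over `□₀^{route}` — near-identity `‖W♯ − 1‖ ≤ 1∕4` and `i·η·X(z,ν) = log W♯(z,ν)` for
`W♯(z,ν) := w(z)⁻¹·U⟨0+z,ν⟩·w(z+e_ν)` — the three torus rows `hnear`, `hA`, `hA0` (any integer preimage `z` of a bond of `□₀^{route}` is handled through its window representative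
and rep-coherence). [cite: Balaban1985RegularSpaces, (1.36)-(1.38) p.82] -/
theorem junction_chart (x₀ : Site (F.P K) 0) (ρ S M : ℕ) (hM : 1 ≤ M)
    {a : LSite (F.P K).d} {M' ρ' : ℕ} (h0 : ρ + M ≤ ρ' + 1) (h1 : (F.P K).L + S + M ≤ ρ' + 2)
    (ha : ∀ ν, a ν ≤ ((iterBlockOf (K - n) x₀ ν).val : ℤ) ∧ ((iterBlockOf (K - n) x₀ ν).val : ℤ) ≤ a ν + M' - 1)
    (hroom : 2 * ((F.P K).L ^ (K - n) * (M' + 1) + ρ' * gs (F.P K).L (K - n)) ≤ (F.P K).sitesPerDir 0)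
    (U : GaugeField (F.P K) 0 (Matrix.specialUnitaryGroup (Fin 2) ℂ)) (w : LSite (F.P K).d → Matrix.specialUnitaryGroup (Fin 2) ℂ)
    (X : LSite (F.P K).d → Fin (F.P K).d → Matrix (Fin 2) (Fin 2) ℂ) (η : ℝ)
    (hWnear : ∀ z ∈ cube (F.P K).L a M' ρ' (K - n) 0, ∀ ν : Fin (F.P K).d,
      transl (0 : Site (F.P K) 0) z ∈ cubeSetM x₀ (K - n) ρ S M 0 → (transl (0 : Site (F.P K) 0) z).shift ν ∈ cubeSetM x₀ (K - n) ρ S M 0 →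
      ‖(((Unitary.toUnits (suIncl (w z)))⁻¹ * unitsField (toUField U) ⟨transl 0 z, ν⟩ * Unitary.toUnits (suIncl (w (z + e ν))) :
          (Matrix (Fin 2) (Fin 2) ℂ)ˣ) : Matrix (Fin 2) (Fin 2) ℂ) - 1‖ ≤ 1 / 4)
    (hX : ∀ z ∈ cube (F.P K).L a M' ρ' (K - n) 0, ∀ ν : Fin (F.P K).d,
      transl (0 : Site (F.P K) 0) z ∈ cubeSetM x₀ (K - n) ρ S M 0 → (transl (0 : Site (F.P K) 0) z).shift ν ∈ cubeSetM x₀ (K - n) ρ S M 0 →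
      I • (η • X z ν) = mlog (((Unitary.toUnits (suIncl (w z)))⁻¹ * unitsField (toUField U) ⟨transl 0 z, ν⟩ * Unitary.toUnits (suIncl (w (z + e ν))) :
          (Matrix (Fin 2) (Fin 2) ℂ)ˣ) : Matrix (Fin 2) (Fin 2) ℂ)) :
    (∀ (z : LSite (F.P K).d) (μ : Fin (F.P K).d), transl (0 : Site (F.P K) 0) z ∈ cubeSetM x₀ (K - n) ρ S M 0 →
      (transl (0 : Site (F.P K) 0) z).shift μ ∈ cubeSetM x₀ (K - n) ρ S M 0 →
      ‖(((Unitary.toUnits (suIncl ((fun s : Site (F.P K) 0 => w (lift (F.P K) x₀ + rel x₀ s)) (transl 0 z))))⁻¹ * unitsField (toUField U) ⟨transl 0 z, μ⟩ *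
          Unitary.toUnits (suIncl ((fun s : Site (F.P K) 0 => w (lift (F.P K) x₀ + rel x₀ s)) ((transl 0 z).shift μ))) : (Matrix (Fin 2) (Fin 2) ℂ)ˣ) :
          Matrix (Fin 2) (Fin 2) ℂ) - 1‖ ≤ 1 / 4) ∧
    (∀ (z : LSite (F.P K).d) (μ : Fin (F.P K).d), transl (0 : Site (F.P K) 0) z ∈ cubeSetM x₀ (K - n) ρ S M 0 →
      (transl (0 : Site (F.P K) 0) z).shift μ ∈ cubeSetM x₀ (K - n) ρ S M 0 →
      I • (η • (fun b : PBond (F.P K) 0 => if b.src ∈ cubeSetM x₀ (K - n) ρ S M 0 ∧ b.tgt ∈ cubeSetM x₀ (K - n) ρ S M 0 then X (lift (F.P K) x₀ + rel x₀ b.src) b.dir else 0) ⟨transl 0 z, μ⟩) =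
        mlog (((Unitary.toUnits (suIncl ((fun s : Site (F.P K) 0 => w (lift (F.P K) x₀ + rel x₀ s)) (transl 0 z))))⁻¹ * unitsField (toUField U) ⟨transl 0 z, μ⟩ *
          Unitary.toUnits (suIncl ((fun s : Site (F.P K) 0 => w (lift (F.P K) x₀ + rel x₀ s)) ((transl 0 z).shift μ))) : (Matrix (Fin 2) (Fin 2) ℂ)ˣ) :
          Matrix (Fin 2) (Fin 2) ℂ)) ∧
    (∀ b : PBond (F.P K) 0, ¬ (∃ z : LSite (F.P K).d, transl (0 : Site (F.P K) 0) z ∈ cubeSetM x₀ (K - n) ρ S M 0 ∧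
      (transl (0 : Site (F.P K) 0) z).shift b.dir ∈ cubeSetM x₀ (K - n) ρ S M 0 ∧ b = ⟨transl 0 z, b.dir⟩) →
      (fun b : PBond (F.P K) 0 => if b.src ∈ cubeSetM x₀ (K - n) ρ S M 0 ∧ b.tgt ∈ cubeSetM x₀ (K - n) ρ S M 0 then X (lift (F.P K) x₀ + rel x₀ b.src) b.dir else 0) b = 0) := by
  have hk : K - n ≤ (F.P K).m + (F.P K).K := FlatMinimizerH.le_T3 F n K
  have hcov : ∀ s : Site (F.P K) 0, transl (0 : Site (F.P K) 0) (lift (F.P K) x₀ + rel x₀ s) = s := fun s => by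
    rw [transl_zero_eq_cover]; exact cover_lift_add_rel x₀ s
  refine ⟨fun z μ hs hs' => ?_, fun z μ hs hs' => ?_, fun b hb => ?_⟩
  · have hz' := lift_add_rel_mem_cube_zero hk hM h0 h1 ha hs
    have h := hWnear _ hz' μ (by rw [hcov]; exact hs) (by rw [hcov]; exact hs')
    rw [hcov] at h
    dsimp only
    rw [rep_shift hk hM h0 h1 ha hroom hs μ hs']
    exact h
  · have hz' := lift_add_rel_mem_cube_zero hk hM h0 h1 ha hs
    have h := hX _ hz' μ (by rw [hcov]; exact hs) (by rw [hcov]; exact hs')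
    rw [hcov] at h
    dsimp only
    rw [if_pos ⟨hs, hs'⟩, rep_shift hk hM h0 h1 ha hroom hs μ hs']
    exact h
  · obtain ⟨src, dir⟩ := b
    dsimp only
    rw [if_neg]
    rintro ⟨hsrc, htgt⟩
    exact hb ⟨lift (F.P K) x₀ + rel x₀ src, by rw [hcov]; exact hsrc, by rw [hcov]; exact htgt, by rw [hcov]⟩

end Torus

end Summit.QuantumFields.YangMills.Theorems.HalvingP1FlatCoreJunction

end
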